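import Summits.FinalStateConjecture.FinalStateConjecture.Theses.LogTimeThreeAnnuli
import Summits.FinalStateConjecture.FinalStateConjecture.Theses.PhaseMixingCapture
import HarnessLib

/-!
# `LogTimeThreeAnnuli.SubconvergentEraGeneric` (stmt-FinalStateConjecture-17490) contains tame weak cosmic
# censorship: the cross-route link to `PhaseMixingCapture.WeakCosmicCensorshipTame` (stmt-FinalStateConjecture-17269)

A `--supports` piece for the IMPORT crux `SubconvergentEraGeneric` of route LogTimeThreeAnnuli, recording in
the tree what its line card and the K-import analysis say in prose: the crux's tame-generic property
("every MGHD has complete `𝓘⁺` AND carries an honest all-`k` windowed boosted subconvergent final era")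
contains the tame-generic weak-cosmic-censorship property of the sibling route PhaseMixingCapture, item
`WeakCosmicCensorshipTame` ("an MGHD exists and every MGHD has complete `𝓘⁺`"), as soon as the shared
anti-vacuity support item `MGHDExists` (stmt-FinalStateConjecture-9937, here in LogTimeThreeAnnuli's copy) is
supplied pointwise.  The proof is the monotonicity of `InitialDataSet.IsTameChristodoulouGeneric` in the
property: drop the era conjunct, add the MGHD-existence conjunct from `MGHDExists`; the crux's tame immersed
injective admissible curve through an exceptional datum serves verbatim.

Consequences made machine-visible: a refutation of `WeakCosmicCensorshipTame` refutes
`SubconvergentEraGeneric ∧ MGHDExists`; a proof of `SubconvergentEraGeneric` (with `MGHDExists`) closes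
stmt-FinalStateConjecture-17269.  Nothing is credited towards either crux.  This module imports two Theses
files and is therefore never a closing file.

Sources: Christodoulou, CQG 16 (1999) A23, p. A24 (genericity by positive codimension, monotone in the
property); Dafermos–Luk arXiv:1710.01722, §1.2.1 and p. 5 (complete `𝓘⁺` for generic data = weak cosmic
censorship, contained in the final state conjecture).
-/

noncomputable section

-- the doubled `FinalStateConjecture` path component is the summit/problem naming scheme
set_option linter.dupNamespace false

namespace Summit.FinalStateConjecture.FinalStateConjecture.Theorems.LogTimeThreeAnnuli.SubconvergentEraGeneric

open Summit.FinalStateConjecture.FinalStateConjecture.Theses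

/-- **The crux contains tame weak cosmic censorship.**  `LogTimeThreeAnnuli.SubconvergentEraGeneric`
together with the anti-vacuity support item `LogTimeThreeAnnuli.MGHDExists` implies the sibling crux
`PhaseMixingCapture.WeakCosmicCensorshipTame` (tame-generically: an MGHD exists and every MGHD has complete
`𝓘⁺`): monotonicity of tame Christodoulou genericity in the property — a datum exceptional for
"MGHD exists ∧ every MGHD has complete `𝓘⁺`" is (given `MGHDExists`) exceptional for "every MGHD has
complete `𝓘⁺` ∧ era", and the crux's tame immersed injective admissible curve through it has all its
other members satisfying the weaker property.  Christodoulou, CQG 16 (1999) A23, p. A24; Dafermos–Luk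
arXiv:1710.01722, p. 5. [cite: Christodoulou1999, p. A24] -/
theorem weakCosmicCensorshipTame_of_subconvergentEraGeneric_of_mghdExists : Summit.FinalStateConjecture.FinalStateConjecture.Theses.LogTimeThreeAnnuli.SubconvergentEraGeneric → Summit.FinalStateConjecture.FinalStateConjecture.Theses.LogTimeThreeAnnuli.MGHDExists → Summit.FinalStateConjecture.FinalStateConjecture.Theses.PhaseMixingCapture.WeakCosmicCensorshipTame := by
  intro hS hM X _ _ _ _ _ _ d hd
  obtain ⟨e, F, hF, hI, h0, hinj, hadm, hE⟩ := hS X d ⟨hd.1, fun h => hd.2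
    ⟨hM X d hd.1, fun 𝒟 hmax => (h 𝒟 hmax).1⟩⟩
  exact ⟨e, F, hF, hI, h0, hinj, hadm, fun c hc hmem => hE c hc ⟨hmem.1, fun h => hmem.2
    ⟨hM X (F c) hmem.1, fun 𝒟 hmax => (h 𝒟 hmax).1⟩⟩⟩

end Summit.FinalStateConjecture.FinalStateConjecture.Theorems.LogTimeThreeAnnuli.SubconvergentEraGeneric

end
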